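import Mathlib
import HarnessLib
import Literature.NumberTheory.LFunctions.HorocycleZeroMode
import Literature.NumberTheory.LFunctions.AbelPowerBound

/-!
# Zero-mode lemma with a rate: `∑_{c≥1} (φ(c)/c) k(λc) = A/λ + O(λ^{-β})`

Topic `Literature/NumberTheory/LFunctions`. Everything in this file is PROVED (no definitions,
no named facts). It sharpens the tree's `HorocycleZeroMode.zeroMode_bound`
(`∑_{c ≥ 1} (φ(c)/c) k(lc) = (∑_d μ(d)/d²)(∫k)/l + O(1)`, the zero Fourier mode of the
unfolded closed-horocycle average, Iwaniec, *Spectral methods*, §3.4) from `O(1)` to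
`O(l^{-β})` when the harmonic Möbius sums satisfy `‖∑_{d ≤ t} μ(d)/d‖ ≤ C₁ t^β` with
`-1 < β ≤ 0` — for `β = θ - 1 + ε` this is the input `∑_{d≤x} μ(d)/d = O(x^{θ-1+ε})` available
under the quasi-Riemann hypothesis `ζ ≠ 0` on `θ < Re s < 1`
(`AbelPowerBound.norm_partialSum_div_le` fed with `M(x) = O(x^{θ+ε})`,
tree `mertens_isBigO_of_quasiRiemannHypothesis_holds`), and it is the zero-mode step of the
elementary proof of the conditional rate `Literature.NumberTheory.LFunctions.horocycleRate_of_quasiRH`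
(Zagier 1981, §1 p. 279; Sarnak 1981, Thm. 1).

* `exists_norm_rowDeriv_le` — for `k ∈ C³` vanishing on `[R,∞)`: the derivative of a complete
  row is `∑_m m k'(mu) = -(∫k)/u² + O(1)` UNIFORMLY in `u > 0` (the tree's first-order
  Euler–Maclaurin row lemma `norm_row_sub_le` applied to `ψ(v) = v k'(v)`, `∫ψ = -∫k`).
* `norm_sum_moebius_rowError_le` — the error rows `E(u) = ∑_{m=0}^{M} k(mu) - (∫k)/u - k(0)/2`
  summed against `μ(d)/d` by Abel summation: `O(l^{-β})`, because `E'` is bounded.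
* `zeroMode_bound_of_partialSum_le` — the zero-mode lemma with rate `C l^{-β}`, uniformly in
  `0 < l ≤ min 1 (R/2)` and `N ≥ R/l`; for `β = 0` it is the tree's `zeroMode_bound` again
  (with the unconditional `∑_{d ≤ x} μ(d)/d = O(1)`).

## References
* H. Iwaniec, *Spectral Methods of Automorphic Forms*, 2nd ed., AMS GSM 53 (2002), §3.4
  [Iwaniec2002].
* D. Zagier, *Eisenstein series and the Riemann zeta-function*, in: Automorphic Forms,
  Representation Theory and Arithmetic (Bombay 1979), Springer 1981, 275–301, §1 [Zagier1981].

## Mathlib / tree search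
Tree: `HorocycleZeroMode.norm_row_sub_le`, `sum_totient_div_mul_eq`, `summable_moebius_div_sq`,
`hasDerivAt_of_contDiff_two`, `deriv_deriv_eq_zero_of_gt` (all reused);
`AbelPowerBound.norm_sum_mul_le_of_partialSum_le`, `norm_tsum_div_sub_sum_le_of_partialSum_le`.
Mathlib: `intervalIntegral.integral_mul_deriv_eq_deriv_mul`, `integral_rpow`.
-/

noncomputable section


open Real Complex MeasureTheory Set Filter Finset intervalIntegral
open scoped Topology

namespace Literature.NumberTheory.LFunctions

namespace HorocycleZeroMode

/-! ### The derivative of a row: `∑_m m k'(um) = -(∫k)/u² + O(1)` -/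

/-- Unpacking `ContDiff ℝ 3`: `k'` is `C²`, and `k` is `C²`. [folklore] -/
theorem contDiff_two_deriv_of_contDiff_three {k : ℝ → ℂ} (hk : ContDiff ℝ 3 k) :
    ContDiff ℝ 2 (deriv k) ∧ ContDiff ℝ 2 k := by
  rw [show (3 : WithTop ℕ∞) = 2 + 1 by norm_num] at hk
  exact ⟨(contDiff_succ_iff_deriv.mp hk).2.2, hk.of_le (by norm_num)⟩

/-- A `C²` function vanishing on `[R, ∞)` has derivative vanishing on `[R, ∞)` (at `R` by
continuity of `k'`). [folklore] -/
theorem deriv_eq_zero_of_ge {k : ℝ → ℂ} (hk : ContDiff ℝ 2 k) {R : ℝ}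
    (hkR : ∀ s, R ≤ s → k s = 0) {s : ℝ} (hs : R ≤ s) : deriv k s = 0 := by
  rcases hs.lt_or_eq with h | h
  · exact (deriv_deriv_eq_zero_of_gt hkR h).1
  · subst h
    have hc : Continuous (deriv k) := (hasDerivAt_of_contDiff_two hk).2.2.1
    have h1 : Tendsto (deriv k) (𝓝[>] R) (𝓝 (deriv k R)) :=
      hc.continuousAt.continuousWithinAt.tendsto
    have h2 : Tendsto (deriv k) (𝓝[>] R) (𝓝 0) := by
      refine tendsto_const_nhds.congr' ?_
      filter_upwards [self_mem_nhdsWithin] with t ht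
      exact ((deriv_deriv_eq_zero_of_gt hkR ht).1).symm
    exact tendsto_nhds_unique h1 h2

/-- The auxiliary function `ψ(v) = v k'(v)`: it is `C²` when `k` is `C³`, vanishes on `[R, ∞)`
with `k`, `ψ(0) = 0`, and `∫₀^R ψ = -∫₀^R k` (integration by parts, `k(R) = 0`). [folklore] -/
theorem psi_props {k : ℝ → ℂ} (hk : ContDiff ℝ 3 k) {R : ℝ}
    (hkR : ∀ s, R ≤ s → k s = 0) :
    ContDiff ℝ 2 (fun v : ℝ => (v : ℂ) * deriv k v) ∧
      (∀ s, R ≤ s → (fun v : ℝ => (v : ℂ) * deriv k v) s = 0) ∧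
      (∫ s in (0 : ℝ)..R, (s : ℂ) * deriv k s) = -∫ s in (0 : ℝ)..R, k s := by
  obtain ⟨hk1, hk2⟩ := contDiff_two_deriv_of_contDiff_three hk
  refine ⟨?_, fun s hs => ?_, ?_⟩
  · exact (Complex.ofRealCLM.contDiff.of_le le_top).mul hk1
  · simp only [deriv_eq_zero_of_ge hk2 hkR hs, mul_zero]
  · obtain ⟨hd, -, hc1, -⟩ := hasDerivAt_of_contDiff_two hk2
    have hu : ∀ x ∈ uIcc (0 : ℝ) R, HasDerivAt (fun v : ℝ => (v : ℂ)) 1 x := fun x _ =>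
      Complex.ofRealCLM.hasDerivAt
    have hv : ∀ x ∈ uIcc (0 : ℝ) R, HasDerivAt k (deriv k x) x := fun x _ => hd x
    have := intervalIntegral.integral_mul_deriv_eq_deriv_mul hu hv
      (intervalIntegrable_const) (hc1.intervalIntegrable _ _)
    rw [this, hkR R le_rfl]
    simp

/-- **Derivative of a row.** For `k ∈ C³` vanishing on `[R, ∞)` (`R ≥ 0`) there is `L` such that
for all `u > 0` and `M` with `M u ≥ R`:
`‖∑_{m=0}^{M} m k'(m u) + (∫₀^R k)/u²‖ ≤ L` — the first-order Euler–Maclaurin row lemma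
`norm_row_sub_le` applied to `ψ(v) = v k'(v)`, whose integral is `-∫k` and whose value at `0`
vanishes; `L = (1/8) ∫₀^R ‖ψ''‖`. [folklore] -/
theorem exists_norm_rowDeriv_le {k : ℝ → ℂ} (hk : ContDiff ℝ 3 k) {R : ℝ} (hR : 0 ≤ R)
    (hkR : ∀ s, R ≤ s → k s = 0) :
    ∃ L : ℝ, 0 ≤ L ∧ ∀ u : ℝ, 0 < u → ∀ M : ℕ, R ≤ M * u →
      ‖∑ m ∈ Finset.range (M + 1), (m : ℂ) * deriv k (m * u) +
          (∫ s in (0 : ℝ)..R, k s) / (u : ℂ) ^ 2‖ ≤ L := by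
  obtain ⟨hψ, hψR, hψI⟩ := psi_props hk hkR
  set ψ : ℝ → ℂ := fun v : ℝ => (v : ℂ) * deriv k v with hψdef
  refine ⟨(1 / 8) * ∫ s in (0 : ℝ)..R, ‖deriv (deriv ψ) s‖, ?_, fun u hu M hM => ?_⟩
  · exact mul_nonneg (by norm_num)
      (intervalIntegral.integral_nonneg hR fun s _ => norm_nonneg (deriv (deriv ψ) s))
  have h := norm_row_sub_le hψ hψR hu hM
  have hψ0 : ψ 0 = 0 := by simp [hψdef]
  rw [hψ0, zero_div, sub_zero, hψI] at h
  -- `∑ ψ(m u) = u ∑ m k'(m u)`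
  have hsum : ∑ m ∈ Finset.range (M + 1), ψ (m * u) =
      (u : ℂ) * ∑ m ∈ Finset.range (M + 1), (m : ℂ) * deriv k (m * u) := by
    rw [Finset.mul_sum]
    refine Finset.sum_congr rfl fun m _ => ?_
    simp only [hψdef]
    push_cast
    ring
  rw [hsum] at h
  have hu0 : (u : ℂ) ≠ 0 := by exact_mod_cast hu.ne'
  have e : (u : ℂ) * ∑ m ∈ Finset.range (M + 1), (m : ℂ) * deriv k (m * u) -
      (-∫ s in (0 : ℝ)..R, k s) / u =
      (u : ℂ) * (∑ m ∈ Finset.range (M + 1), (m : ℂ) * deriv k (m * u) +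
        (∫ s in (0 : ℝ)..R, k s) / (u : ℂ) ^ 2) := by
    rw [neg_div, sub_neg_eq_add, mul_add]
    congr 1
    rw [pow_two, ← div_div, mul_div_cancel₀ _ hu0]
  rw [e, norm_mul, Complex.norm_real, Real.norm_of_nonneg hu.le] at h
  have h2 : u * ‖∑ m ∈ Finset.range (M + 1), (m : ℂ) * deriv k (m * u) +
      (∫ s in (0 : ℝ)..R, k s) / (u : ℂ) ^ 2‖ ≤
      u * ((1 / 8) * ∫ s in (0 : ℝ)..R, ‖deriv (deriv ψ) s‖) := by
    refine h.trans (le_of_eq ?_)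
    ring
  exact le_of_mul_le_mul_left h2 hu


/-! ### The zero-mode sum with a rate -/


open scoped ArithmeticFunction.Moebius in
/-- **The error rows against `μ(d)/d`.** With complete rows `T(u) = ∑_{m=0}^{M} k(m u)` and
`E(u) = T(u) - I/u - k(0)/2` (`I = ∫₀^R k`), Abel summation against `μ(d)/d`
(`AbelPowerBound.norm_sum_mul_le_of_partialSum_le`, partial sums `‖∑_{d≤t} μ(d)/d‖ ≤ C₁ t^β`)
and the bounded derivative of `E` (`‖E'(u)‖ ≤ L`, `exists_norm_rowDeriv_le`) give
`‖∑_{d ≤ D} (μ(d)/d) E(l d)‖ ≤ (C₁ (2/R)^{-β} (K₀ + 2‖I‖/R + ‖k 0‖/2) + C₁ L R^{β+1}/(β+1)) l^{-β}`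
for `D = ⌊R/l⌋`, `M = D + 1`, `0 < l ≤ R/2`. [folklore] -/
theorem norm_sum_moebius_rowError_le {k : ℝ → ℂ} (hd1 : ∀ t, HasDerivAt k (deriv k t) t)
    (hc1 : Continuous (deriv k)) {R : ℝ} (hR : 0 < R) (hkR : ∀ s, R ≤ s → k s = 0)
    {K₀ : ℝ} (hkb : ∀ s : ℝ, 0 ≤ s → ‖k s‖ ≤ K₀) {I : ℂ} {L : ℝ} (hL0 : 0 ≤ L)
    (hL : ∀ u : ℝ, 0 < u → ∀ M : ℕ, R ≤ M * u →
      ‖∑ m ∈ Finset.range (M + 1), (m : ℂ) * deriv k (m * u) + I / (u : ℂ) ^ 2‖ ≤ L)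
    {C₁ β : ℝ} (hβ : -1 < β) (hC₁ : 0 ≤ C₁)
    (hA : ∀ t : ℝ, 1 ≤ t → ‖∑ d ∈ Finset.Icc 0 ⌊t⌋₊, (μ d : ℂ) / d‖ ≤ C₁ * t ^ β)
    {l : ℝ} (hl : 0 < l) (hlR : l ≤ R / 2) {D : ℕ} (hD1 : 1 ≤ D) (hDle : (D : ℝ) ≤ R / l)
    (hDl' : R < (D + 1 : ℝ) * l) (hDβ : (D : ℝ) ^ β ≤ (2 / R) ^ (-β) * l ^ (-β)) :
    ‖∑ d ∈ Finset.Ioc 0 D, ((μ d : ℂ) / d) *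
        ((∑ m ∈ Finset.range (D + 1 + 1), k (m * (l * d))) - I / (l * d : ℝ) - k 0 / 2)‖ ≤
      (C₁ * (2 / R) ^ (-β) * (K₀ + 2 * ‖I‖ / R + ‖k 0‖ / 2) +
        C₁ * (L * R ^ (β + 1) / (β + 1))) * l ^ (-β) := by
  have hβ1 : 0 < β + 1 := by linarith
  have hD0 : (0 : ℝ) < D := by exact_mod_cast (lt_of_lt_of_le zero_lt_one hD1)
  set M : ℕ := D + 1 with hM
  have hMl : R ≤ (M : ℝ) * l := by rw [hM]; push_cast; linarith
  obtain ⟨T, hT⟩ : ∃ T : ℝ → ℂ, T = fun u => ∑ m ∈ Finset.range (M + 1), k (m * u) := ⟨_, rfl⟩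
  obtain ⟨E, hE⟩ : ∃ E : ℝ → ℂ, E = fun u => T u - I / u - k 0 / 2 := ⟨_, rfl⟩
  have hgoal : ∀ d ∈ Finset.Ioc 0 D, ((μ d : ℂ) / d) *
      ((∑ m ∈ Finset.range (D + 1 + 1), k (m * (l * d))) - I / (l * d : ℝ) - k 0 / 2) =
      ((μ d : ℂ) / d) * E (l * d) := by
    intro d _
    simp only [hE, hT, hM]
  rw [Finset.sum_congr rfl hgoal]
  -- Abel summation with `c d = μ(d)/d`, `h t = E (l t)`, `m = D`
  obtain ⟨c, hc⟩ : ∃ c : ℕ → ℂ, c = fun d => (μ d : ℂ) / d := ⟨_, rfl⟩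
  obtain ⟨h, hh⟩ : ∃ h : ℝ → ℂ, h = fun t => E (l * t) := ⟨_, rfl⟩
  have hc0 : c 0 = 0 := by rw [hc]; simp
  have hsum : ∑ d ∈ Finset.Ioc 0 D, ((μ d : ℂ) / d) * E (l * d) =
      ∑ d ∈ Finset.Icc 0 D, h d * c d := by
    rw [Finset.Icc_eq_cons_Ioc (Nat.zero_le D), Finset.sum_cons, hc0, mul_zero, zero_add]
    exact Finset.sum_congr rfl fun d _ => by simp only [hh, hc]; ring
  rw [hsum]
  -- the derivative of `h` on `(0, ∞)`: `h' t = l G(l t)`, `G u = ∑ m k'(m u) + I/u²`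
  obtain ⟨G, hGdef⟩ : ∃ G : ℝ → ℂ, G = fun u => ∑ m ∈ Finset.range (M + 1),
      (m : ℂ) * deriv k (m * u) + I / (u : ℂ) ^ 2 := ⟨_, rfl⟩
  have hE_eq : h = fun t : ℝ => ∑ m ∈ Finset.range (M + 1), k (m * (l * t)) -
      (((l * t)⁻¹ : ℝ) : ℂ) * I - k 0 / 2 := by
    funext t
    simp only [hh, hE, hT]
    push_cast
    ring
  have hderiv' : ∀ t : ℝ, 0 < t → HasDerivAt (fun t : ℝ => ∑ m ∈ Finset.range (M + 1),
      k (m * (l * t)) - (((l * t)⁻¹ : ℝ) : ℂ) * I - k 0 / 2) ((l : ℂ) * G (l * t)) t := by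
    intro t ht
    have hlt : l * t ≠ 0 := (mul_pos hl ht).ne'
    have h1 : ∀ m ∈ Finset.range (M + 1), HasDerivAt (fun t : ℝ => k (m * (l * t)))
        ((m * l : ℝ) • deriv k (m * (l * t))) t := by
      intro m _
      have hlin : HasDerivAt (fun t : ℝ => (m : ℝ) * (l * t)) (m * l) t := by
        have := ((hasDerivAt_id t).const_mul l).const_mul (m : ℝ)
        simpa [mul_assoc] using this
      exact (hd1 _).scomp t hlin
    have h2 : HasDerivAt (fun t : ℝ => (((l * t)⁻¹ : ℝ) : ℂ) * I)
        (((-(l) / (l * t) ^ 2 : ℝ) : ℂ) * I) t := by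
      have hlin : HasDerivAt (fun t : ℝ => l * t) l t := by
        simpa using (hasDerivAt_id t).const_mul l
      have hinv := hlin.inv hlt
      exact hinv.ofReal_comp.mul_const I
    have hall := ((HasDerivAt.fun_sum h1).fun_sub h2).sub_const (k 0 / 2)
    refine hall.congr_deriv ?_
    have eG : (l : ℂ) * G (l * t) = (∑ m ∈ Finset.range (M + 1),
        (l : ℂ) * ((m : ℂ) * deriv k (m * (l * t)))) + (l : ℂ) * (I / ((l * t : ℝ) : ℂ) ^ 2) := by
      simp only [hGdef, mul_add, Finset.mul_sum]
    rw [eG, sub_eq_add_neg]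
    congr 1
    · refine Finset.sum_congr rfl fun m _ => ?_
      rw [Complex.real_smul]
      push_cast
      ring
    · have hl0 : (l : ℂ) ≠ 0 := by exact_mod_cast hl.ne'
      have ht0 : (t : ℂ) ≠ 0 := by exact_mod_cast ht.ne'
      push_cast
      field_simp
  have hderiv : ∀ t : ℝ, 0 < t → HasDerivAt h ((l : ℂ) * G (l * t)) t := fun t ht => by
    rw [hE_eq]; exact hderiv' t ht
  have hGb : ∀ t : ℝ, 1 ≤ t → ‖(l : ℂ) * G (l * t)‖ ≤ l * L := by
    intro t ht
    have hu : 0 < l * t := by positivity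
    have hMl0 : 0 ≤ (M : ℝ) * l := by positivity
    have hMu : R ≤ (M : ℝ) * (l * t) :=
      calc R ≤ (M : ℝ) * l := hMl
        _ = (M : ℝ) * l * 1 := by ring
        _ ≤ (M : ℝ) * l * t := mul_le_mul_of_nonneg_left ht hMl0
        _ = (M : ℝ) * (l * t) := by ring
    have hGu : ‖G (l * t)‖ ≤ L := by rw [hGdef]; exact hL (l * t) hu M hMu
    rw [norm_mul, Complex.norm_real, Real.norm_of_nonneg hl.le]
    exact mul_le_mul_of_nonneg_left hGu hl.le
  -- continuity of `t ↦ l G(l t)` on `[1, D]`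
  have hGc : ContinuousOn (fun t : ℝ => (l : ℂ) * G (l * t)) (Set.Icc (1 : ℝ) D) := by
    have e : (fun t : ℝ => (l : ℂ) * G (l * t)) = fun t : ℝ => (l : ℂ) *
        (∑ m ∈ Finset.range (M + 1), (m : ℂ) * deriv k (m * (l * t)) +
          I / ((l * t : ℝ) : ℂ) ^ 2) := by
      funext t; simp only [hGdef]
    rw [e]
    refine continuousOn_const.mul (ContinuousOn.add ?_ ?_)
    · refine Continuous.continuousOn (continuous_finsetSum _ fun m _ => ?_)
      exact continuous_const.mul (hc1.comp (continuous_const.mul (continuous_const.mul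
        continuous_id)))
    · refine continuousOn_const.div ?_ fun t ht => ?_
      · exact ((Complex.continuous_ofReal.comp (continuous_const.mul continuous_id)).pow 2
          ).continuousOn
      · have : 0 < l * t := by have := ht.1; positivity
        exact pow_ne_zero 2 (by exact_mod_cast this.ne')
  have hderiv_eq : Set.EqOn (deriv h) (fun t : ℝ => (l : ℂ) * G (l * t)) (Set.Icc (1 : ℝ) D) :=
    fun t ht => (hderiv t (by linarith [ht.1])).deriv
  have hd : ∀ t ∈ Set.Icc (1 : ℝ) D, DifferentiableAt ℝ h t := fun t ht =>
    (hderiv t (by linarith [ht.1])).differentiableAt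
  have hi : IntegrableOn (deriv h) (Set.Icc (1 : ℝ) D) :=
    hGc.integrableOn_Icc.congr_fun hderiv_eq.symm measurableSet_Icc
  have hpc : ContinuousOn (fun t : ℝ => t ^ β * ‖(l : ℂ) * G (l * t)‖) (Set.Icc (1 : ℝ) D) := by
    refine ContinuousOn.mul (ContinuousOn.rpow_const (by fun_prop) fun t ht => ?_) hGc.norm
    exact Or.inl (lt_of_lt_of_le one_pos ht.1).ne'
  have hi' : IntegrableOn (fun t : ℝ => t ^ β * ‖deriv h t‖) (Set.Icc (1 : ℝ) D) := by
    refine hpc.integrableOn_Icc.congr_fun (fun t ht => ?_) measurableSet_Icc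
    rw [hderiv_eq ht]
  have hA' : ∀ t : ℝ, 1 ≤ t → ‖∑ d ∈ Finset.Icc 0 ⌊t⌋₊, c d‖ ≤ C₁ * t ^ β := fun t ht => by
    simp only [hc]; exact hA t ht
  have habel := AbelPowerBound.norm_sum_mul_le_of_partialSum_le (c := c) (h := h) (m := D)
    hc0 hA' hD1 hd hi hi'
  refine habel.trans ?_
  -- the boundary term: `‖h D‖ ≤ K₀ + 2‖I‖/R + ‖k 0‖/2`, `D^β ≤ 1`
  have hlD : R - l < l * D := by linarith only [hDl']
  have hlD2 : R / 2 ≤ l * D := by linarith only [hlD, hlR]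
  have hTD : T (l * D) = k 0 + k (l * D) := by
    rw [hT]
    dsimp only
    have hz : ∀ m ∈ Finset.range (M + 1), m ∉ Finset.range 2 → k (m * (l * D)) = 0 := by
      intro m _ hm
      rw [Finset.mem_range, not_lt] at hm
      refine hkR _ ?_
      have h2m : (2 : ℝ) ≤ m := by exact_mod_cast hm
      nlinarith only [h2m, hlD2, hR]
    rw [← Finset.sum_subset (Finset.range_subset_range.2 (by omega : 2 ≤ M + 1)) hz]
    simp only [Finset.sum_range_succ, Finset.sum_range_zero, Nat.cast_zero, Nat.cast_one,
      zero_mul, one_mul, zero_add]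
  have hhD : ‖h D‖ ≤ K₀ + 2 * ‖I‖ / R + ‖k 0‖ / 2 := by
    have e : h D = k 0 / 2 + k (l * D) - I / (l * D : ℝ) := by
      simp only [hh, hE, hTD]
      ring
    rw [e]
    have hI : ‖I / (l * D : ℝ)‖ ≤ 2 * ‖I‖ / R := by
      rw [norm_div, Complex.norm_real, Real.norm_of_nonneg (by positivity)]
      rw [div_le_div_iff₀ (by positivity) hR]
      nlinarith only [hlD2, norm_nonneg I]
    calc ‖k 0 / 2 + k (l * D) - I / (l * D : ℝ)‖ ≤ ‖k 0 / 2‖ + ‖k (l * D)‖ + ‖I / (l * D : ℝ)‖ :=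
          norm_sub_le_of_le (norm_add_le _ _) le_rfl
      _ ≤ ‖k 0‖ / 2 + K₀ + 2 * ‖I‖ / R := by
          have h1 : ‖k 0 / 2‖ = ‖k 0‖ / 2 := by rw [norm_div]; norm_num
          rw [h1]
          exact add_le_add (add_le_add le_rfl (hkb _ (by positivity))) hI
      _ = K₀ + 2 * ‖I‖ / R + ‖k 0‖ / 2 := by ring
  have hb1 : C₁ * (D : ℝ) ^ β * ‖h D‖ ≤
      C₁ * (2 / R) ^ (-β) * (K₀ + 2 * ‖I‖ / R + ‖k 0‖ / 2) * l ^ (-β) := by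
    calc C₁ * (D : ℝ) ^ β * ‖h D‖ ≤ C₁ * ((2 / R) ^ (-β) * l ^ (-β)) *
          (K₀ + 2 * ‖I‖ / R + ‖k 0‖ / 2) := by gcongr
      _ = C₁ * (2 / R) ^ (-β) * (K₀ + 2 * ‖I‖ / R + ‖k 0‖ / 2) * l ^ (-β) := by ring
  -- the integral term
  have hb2 : C₁ * ∫ t in (1 : ℝ)..D, t ^ β * ‖deriv h t‖ ≤ C₁ * (L * R ^ (β + 1) / (β + 1)) * l ^ (-β) := by
    have hD1' : (1 : ℝ) ≤ D := by exact_mod_cast hD1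
    have hmono : ∫ t in (1 : ℝ)..D, t ^ β * ‖deriv h t‖ ≤ ∫ t in (1 : ℝ)..D, (l * L) * t ^ β := by
      refine intervalIntegral.integral_mono_on hD1' ?_ ?_ fun t ht => ?_
      · exact (intervalIntegrable_iff_integrableOn_Icc_of_le hD1').2 hi'
      · refine ((ContinuousOn.rpow_const (by fun_prop) fun t ht => ?_).const_mul _).intervalIntegrable_of_Icc hD1'
        exact Or.inl (lt_of_lt_of_le one_pos ht.1).ne'
      · rw [hderiv_eq ht, mul_comm]
        exact mul_le_mul_of_nonneg_right (hGb t ht.1) (Real.rpow_nonneg (by linarith [ht.1]) _)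
    have hint : ∫ t in (1 : ℝ)..D, (l * L) * t ^ β = l * L * (((D : ℝ) ^ (β + 1) - 1) / (β + 1)) := by
      rw [intervalIntegral.integral_const_mul, integral_rpow (Or.inl hβ), Real.one_rpow]
    have hDpow : (D : ℝ) ^ (β + 1) ≤ (R / l) ^ (β + 1) :=
      Real.rpow_le_rpow (by positivity) hDle hβ1.le
    have hRl' : l * (R / l) ^ (β + 1) = R ^ (β + 1) * l ^ (-β) := by
      rw [Real.div_rpow hR.le hl.le, Real.rpow_neg hl.le, Real.rpow_add_one hl.ne']
      field_simp
    calc C₁ * ∫ t in (1 : ℝ)..D, t ^ β * ‖deriv h t‖ ≤ C₁ * (l * L * (((D : ℝ) ^ (β + 1) - 1) / (β + 1))) := by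
          rw [← hint]; exact mul_le_mul_of_nonneg_left hmono hC₁
      _ ≤ C₁ * (l * L * ((R / l) ^ (β + 1) / (β + 1))) := by
          gcongr
          linarith only [hDpow]
      _ = C₁ * (L * R ^ (β + 1) / (β + 1)) * l ^ (-β) := by
          rw [show l * L * ((R / l) ^ (β + 1) / (β + 1)) = L / (β + 1) * (l * (R / l) ^ (β + 1)) by ring,
            hRl']
          ring
  exact (add_le_add hb1 hb2).trans (le_of_eq (by ring))

open scoped ArithmeticFunction.Moebius in
/-- **Zero-mode lemma with a rate.** Let `k : ℝ → ℂ` be `C³` with `k = 0` on `[R, ∞)` (`R > 0`),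
and suppose the harmonic Möbius sums satisfy `‖∑_{d ≤ t} μ(d)/d‖ ≤ C₁ t^β` for `t ≥ 1`, with
`-1 < β ≤ 0` (`β = 0`: bounded, unconditional; `β = θ - 1 + ε` under quasi-RH(`θ`)). Then
`∑_{c ≥ 1} (φ(c)/c) k(l c) = (∑_d μ(d)/d²) (∫_0^R k) / l + O(l^{-β})` uniformly in
`0 < l ≤ min 1 (R/2)` (the sum is finite; any `N ≥ R/l` captures it). Proof:
`φ(c)/c = ∑_{d∣c} μ(d)/d` and complete rows `T(ld) = ∑_{m=0}^{M} k(m l d)`, `M = ⌊R/l⌋ + 1`;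
writing `T(u) = (∫k)/u + k(0)/2 + E(u)` (trapezoidal rule), the three resulting sums are:
`(∫k/l) ∑_{d ≤ D} μ(d)/d²`, completed at cost `O(D^{β-1}/l) = O(l^{-β})` by Abel summation
(`AbelPowerBound.norm_tsum_div_sub_sum_le_of_partialSum_le`); `(k(0)/2) ∑_{d ≤ D} μ(d)/d = O(D^β)`;
and `∑_{d ≤ D} (μ(d)/d) E(ld)`, which is `O(l^{-β})` by Abel summation against `μ(d)/d`
(`AbelPowerBound.norm_sum_mul_le_of_partialSum_le`) since `u ↦ E(u)` has BOUNDED derivative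
(`exists_norm_rowDeriv_le`: `E'(u) = ∑ m k'(mu) + (∫k)/u²`). [folklore] -/
theorem zeroMode_bound_of_partialSum_le {k : ℝ → ℂ} (hk : ContDiff ℝ 3 k) {R : ℝ} (hR : 0 < R)
    (hkR : ∀ s, R ≤ s → k s = 0) {C₁ β : ℝ} (hβ : -1 < β) (hβ0 : β ≤ 0)
    (hA : ∀ t : ℝ, 1 ≤ t → ‖∑ d ∈ Finset.Icc 0 ⌊t⌋₊, (μ d : ℂ) / d‖ ≤ C₁ * t ^ β) :
    ∃ C : ℝ, ∀ l : ℝ, 0 < l → l ≤ 1 → l ≤ R / 2 → ∀ N : ℕ, R ≤ l * N →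
      ‖∑ c ∈ Finset.Ioc 0 N, ((Nat.totient c : ℂ) / c) * k (l * c) -
        (∑' d : ℕ, (μ d : ℂ) / (d : ℂ) ^ 2) * (∫ s in (0 : ℝ)..R, k s) / l‖ ≤ C * l ^ (-β) := by
  obtain ⟨hk1, hk2⟩ := contDiff_two_deriv_of_contDiff_three hk
  obtain ⟨hd1, hd2, hc1, hc2⟩ := hasDerivAt_of_contDiff_two hk2
  obtain ⟨L, hL0, hL⟩ := exists_norm_rowDeriv_le hk hR.le hkR
  have hC₁ : 0 ≤ C₁ := AbelPowerBound.nonneg_of_partialSum_le hA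
  -- a bound for `k` on `[0, R]`, hence everywhere on `[0, ∞)`
  obtain ⟨K₀, hK₀⟩ := (isCompact_Icc (a := (0 : ℝ)) (b := R)).exists_bound_of_continuousOn
    hk.continuous.continuousOn
  have hK₀0 : 0 ≤ K₀ := (norm_nonneg _).trans (hK₀ 0 ⟨le_rfl, hR.le⟩)
  have hkb : ∀ s : ℝ, 0 ≤ s → ‖k s‖ ≤ K₀ := by
    intro s hs
    rcases le_or_gt s R with h | h
    · exact hK₀ s ⟨hs, h⟩
    · rw [hkR s h.le, norm_zero]; exact hK₀0
  -- make the integral opaque (it enters only through `hL` and its norm)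
  generalize hI : (∫ s in (0 : ℝ)..R, k s) = I at hL
  set S : ℂ := ∑' d : ℕ, (μ d : ℂ) / (d : ℂ) ^ 2 with hS
  -- the constant
  set Cst : ℝ := ‖I‖ * (C₁ * (2 + 1 / (1 - β))) * (2 / R) ^ (1 - β) +
    ‖k 0‖ / 2 * C₁ * (2 / R) ^ (-β) + (C₁ * (2 / R) ^ (-β) * (K₀ + 2 * ‖I‖ / R + ‖k 0‖ / 2) +
      C₁ * (L * R ^ (β + 1) / (β + 1))) with hCst
  refine ⟨Cst, fun l hl hl1 hlR N hN => ?_⟩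
  have hβ1 : 0 < β + 1 := by linarith
  have hβ2 : 0 < 1 - β := by linarith
  -- Möbius rearrangement
  rw [sum_totient_div_mul_eq]
  -- `D = ⌊R/l⌋ ≥ 2`, `D ≤ N`, `R/(2l) ≤ D ≤ R/l`
  set D : ℕ := ⌊R / l⌋₊ with hD
  have hRl : 2 ≤ R / l := by rw [le_div_iff₀ hl]; linarith
  have hD2 : 2 ≤ D := Nat.le_floor (by exact_mod_cast hRl)
  have hD1 : 1 ≤ D := le_trans (by norm_num) hD2
  have hDle : (D : ℝ) ≤ R / l := Nat.floor_le (by positivity)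
  have hDl : (D : ℝ) * l ≤ R := by rwa [le_div_iff₀ hl] at hDle
  have hDlt : R / l < D + 1 := Nat.lt_floor_add_one _
  have hDl' : R < (D + 1 : ℝ) * l := by rwa [div_lt_iff₀ hl] at hDlt
  have hDge : R / (2 * l) ≤ D := by
    have h1 : R / l - 1 ≤ D := by linarith
    have h2 : R / (2 * l) = R / l / 2 := by rw [div_div, mul_comm]
    rw [h2]; linarith
  have hDN : D ≤ N := by
    have : (D : ℝ) ≤ N := by
      have h1 : (D : ℝ) * l ≤ l * N := hDl.trans hN
      nlinarith
    exact_mod_cast this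
  have hD0 : (0 : ℝ) < D := by exact_mod_cast hD1
  -- `D^β ≤ (2/R)^{-β} l^{-β}` (`β ≤ 0`, `D ≥ R/(2l)`)
  have hDβ : (D : ℝ) ^ β ≤ (2 / R) ^ (-β) * l ^ (-β) := by
    have h1 : (D : ℝ) ^ β ≤ (R / (2 * l)) ^ β :=
      Real.rpow_le_rpow_of_nonpos (by positivity) hDge hβ0
    refine h1.trans (le_of_eq ?_)
    rw [show R / (2 * l) = ((2 / R) * l)⁻¹ by field_simp, Real.inv_rpow (by positivity),
      ← Real.rpow_neg (by positivity), Real.mul_rpow (by positivity) hl.le]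
  -- rows beyond `D` vanish
  set row : ℕ → ℂ := fun d => ∑ m ∈ Finset.Ioc 0 (N / d), k (l * (d * m : ℕ)) with hrow
  have hvan : ∀ d ∈ Finset.Ioc 0 N, d ∉ Finset.Ioc 0 D → ((μ d : ℂ) / d) * row d = 0 := by
    intro d hd hdD
    rw [Finset.mem_Ioc] at hd hdD
    have hDd : D < d := by
      by_contra h; exact hdD ⟨hd.1, not_lt.mp h⟩
    have hld : R < l * d := by
      have h1 : (D + 1 : ℝ) ≤ d := by exact_mod_cast hDd
      nlinarith
    have : row d = 0 := by
      refine Finset.sum_eq_zero fun m hm => hkR _ ?_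
      rw [Finset.mem_Ioc] at hm
      have : (d : ℝ) ≤ (d * m : ℕ) := by exact_mod_cast Nat.le_mul_of_pos_right d hm.1
      nlinarith
    rw [this, mul_zero]
  rw [← Finset.sum_subset (Finset.Ioc_subset_Ioc_right hDN) hvan]
  -- complete rows `T(u) = ∑_{m=0}^{M} k(m u)`, `M = D + 1`, and `E(u) = T(u) - I/u - k(0)/2`
  set M : ℕ := D + 1 with hM
  have hMl : R ≤ (M : ℝ) * l := by rw [hM]; push_cast; linarith
  set T : ℝ → ℂ := fun u => ∑ m ∈ Finset.range (M + 1), k (m * u) with hT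
  set E : ℝ → ℂ := fun u => T u - I / u - k 0 / 2 with hE
  have hrowT : ∀ d ∈ Finset.Ioc 0 D, row d = T (l * d) - k 0 := by
    intro d hd
    rw [Finset.mem_Ioc] at hd
    have hd0 : 0 < d := hd.1
    have hd0' : (0 : ℝ) < d := by exact_mod_cast hd0
    -- both sums run over the same nonzero terms: compare with the sum over `Ioc 0 (max (N/d) M)`
    have hzero : ∀ m : ℕ, N / d < m ∨ M < m → k (l * (d * m : ℕ)) = 0 := by
      intro m hm
      refine hkR _ ?_
      rcases hm with h | h
      · have h1 : N < d * m := by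
          have := Nat.lt_mul_div_succ N hd0
          calc N < d * (N / d + 1) := by linarith
            _ ≤ d * m := Nat.mul_le_mul_left d h
        have h2 : (N : ℝ) + 1 ≤ (d * m : ℕ) := by exact_mod_cast h1
        nlinarith
      · have h1 : M + 1 ≤ d * m := le_trans h (Nat.le_mul_of_pos_left m hd0)
        have h2 : (M : ℝ) + 1 ≤ (d * m : ℕ) := by exact_mod_cast h1
        nlinarith
    have e1 : row d = ∑ m ∈ Finset.Ioc 0 (max (N / d) M), k (l * (d * m : ℕ)) := by
      rw [hrow]
      refine Finset.sum_subset (Finset.Ioc_subset_Ioc_right (le_max_left _ _)) fun m hm hm' => ?_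
      refine hzero m (Or.inl ?_)
      rw [Finset.mem_Ioc] at hm hm'
      by_contra h
      exact hm' ⟨hm.1, not_lt.mp h⟩
    have e2 : ∑ m ∈ Finset.Ioc 0 M, k (l * (d * m : ℕ)) =
        ∑ m ∈ Finset.Ioc 0 (max (N / d) M), k (l * (d * m : ℕ)) := by
      refine Finset.sum_subset (Finset.Ioc_subset_Ioc_right (le_max_right _ _)) fun m hm hm' => ?_
      refine hzero m (Or.inr ?_)
      rw [Finset.mem_Ioc] at hm hm'
      by_contra h
      exact hm' ⟨hm.1, not_lt.mp h⟩
    rw [e1, ← e2, hT]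
    dsimp only
    rw [Finset.sum_range_succ', sum_Ioc_zero_eq_sum_range]
    push_cast
    simp only [zero_mul]
    rw [add_sub_cancel_right]
    refine Finset.sum_congr rfl fun i _ => ?_
    congr 1
    ring
  -- algebra: split the sum into the three terms
  have halg : ∑ d ∈ Finset.Ioc 0 D, ((μ d : ℂ) / d) * row d - S * I / l =
      ∑ d ∈ Finset.Ioc 0 D, ((μ d : ℂ) / d) * E (l * d) -
        (I / l) * (S - ∑ d ∈ Finset.Ioc 0 D, (μ d : ℂ) / (d : ℂ) ^ 2) -
        (k 0 / 2) * ∑ d ∈ Finset.Ioc 0 D, (μ d : ℂ) / d := by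
    have hl' : (l : ℂ) ≠ 0 := by exact_mod_cast hl.ne'
    have e1 : ∀ d ∈ Finset.Ioc 0 D, ((μ d : ℂ) / d) * row d =
        ((μ d : ℂ) / d) * E (l * d) + (I / l) * ((μ d : ℂ) / (d : ℂ) ^ 2) -
          (k 0 / 2) * ((μ d : ℂ) / d) := by
      intro d hd
      have hd0 : (d : ℂ) ≠ 0 := by exact_mod_cast (Finset.mem_Ioc.1 hd).1.ne'
      rw [hrowT d hd, hE]
      dsimp only
      push_cast
      field_simp
      ring
    rw [Finset.sum_congr rfl e1, Finset.sum_sub_distrib, Finset.sum_add_distrib,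
      ← Finset.mul_sum, ← Finset.mul_sum]
    ring
  rw [halg]
  -- (b2) the completed main term: `‖(I/l)(S - ∑_{d ≤ D} μ(d)/d²)‖ ≤ ‖I‖ C₁(2+1/(1-β)) (2/R)^{1-β} l^{-β}`
  have b2 : ‖(I / l) * (S - ∑ d ∈ Finset.Ioc 0 D, (μ d : ℂ) / (d : ℂ) ^ 2)‖ ≤
      ‖I‖ * (C₁ * (2 + 1 / (1 - β))) * (2 / R) ^ (1 - β) * l ^ (-β) := by
    have htail := AbelPowerBound.norm_tsum_div_sub_sum_le_of_partialSum_le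
      (c := fun d => (μ d : ℂ) / d) (by linarith : β < 1) hA ?_ hD1
    · have eS : ∑' d : ℕ, (μ d : ℂ) / d / d = S := by
        rw [hS]; exact tsum_congr fun d => by rw [div_div, sq]
      have eD : ∑ d ∈ Finset.Icc 0 D, (μ d : ℂ) / d / d = ∑ d ∈ Finset.Ioc 0 D, (μ d : ℂ) / (d : ℂ) ^ 2 := by
        rw [Finset.Icc_eq_cons_Ioc (Nat.zero_le D), Finset.sum_cons]
        simp only [Nat.cast_zero, div_zero, zero_add]
        exact Finset.sum_congr rfl fun d _ => by rw [div_div, sq]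
      rw [eS, eD] at htail
      rw [norm_mul, norm_div, Complex.norm_real, Real.norm_of_nonneg hl.le]
      have hDpow : (D : ℝ) ^ (β - 1) ≤ (2 / R) ^ (1 - β) * l ^ (1 - β) := by
        have h1 : (D : ℝ) ^ (β - 1) ≤ (R / (2 * l)) ^ (β - 1) :=
          Real.rpow_le_rpow_of_nonpos (by positivity) hDge (by linarith)
        refine h1.trans (le_of_eq ?_)
        rw [show β - 1 = -(1 - β) by ring, Real.rpow_neg (by positivity), ← Real.inv_rpow (by positivity),
          inv_div, show 2 * l / R = (2 / R) * l by ring, Real.mul_rpow (by positivity) hl.le]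
      calc ‖I‖ / l * ‖S - ∑ d ∈ Finset.Ioc 0 D, (μ d : ℂ) / (d : ℂ) ^ 2‖
          ≤ ‖I‖ / l * (C₁ * (2 + 1 / (1 - β)) * (D : ℝ) ^ (β - 1)) := by gcongr
        _ ≤ ‖I‖ / l * (C₁ * (2 + 1 / (1 - β)) * ((2 / R) ^ (1 - β) * l ^ (1 - β))) := by
            gcongr
        _ = ‖I‖ * (C₁ * (2 + 1 / (1 - β))) * (2 / R) ^ (1 - β) * (l ^ (1 - β) / l) := by ring
        _ = ‖I‖ * (C₁ * (2 + 1 / (1 - β))) * (2 / R) ^ (1 - β) * l ^ (-β) := by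
            rw [← Real.rpow_sub_one hl.ne', show (1 - β) - 1 = -β by ring]
    · simpa [div_div, sq] using summable_moebius_div_sq
  -- (b3) `‖(k(0)/2) ∑_{d ≤ D} μ(d)/d‖ ≤ (‖k 0‖/2) C₁`
  have b3 : ‖(k 0 / 2) * ∑ d ∈ Finset.Ioc 0 D, (μ d : ℂ) / d‖ ≤
      ‖k 0‖ / 2 * C₁ * (2 / R) ^ (-β) * l ^ (-β) := by
    have h := hA D (by exact_mod_cast hD1)
    rw [Nat.floor_natCast, Finset.Icc_eq_cons_Ioc (Nat.zero_le D), Finset.sum_cons] at h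
    simp only [Nat.cast_zero, div_zero, zero_add] at h
    rw [norm_mul, norm_div]
    norm_num
    calc ‖k 0‖ / 2 * ‖∑ d ∈ Finset.Ioc 0 D, (μ d : ℂ) / d‖ ≤ ‖k 0‖ / 2 * (C₁ * (D : ℝ) ^ β) := by
          gcongr
      _ ≤ ‖k 0‖ / 2 * (C₁ * ((2 / R) ^ (-β) * l ^ (-β))) := by gcongr
      _ = ‖k 0‖ / 2 * C₁ * (2 / R) ^ (-β) * l ^ (-β) := by ring
  -- (b1) the error rows, by Abel summation against `μ(d)/d`
  have b1 : ‖∑ d ∈ Finset.Ioc 0 D, ((μ d : ℂ) / d) * E (l * d)‖ ≤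
      (C₁ * (2 / R) ^ (-β) * (K₀ + 2 * ‖I‖ / R + ‖k 0‖ / 2) +
        C₁ * (L * R ^ (β + 1) / (β + 1))) * l ^ (-β) := by
    have h := norm_sum_moebius_rowError_le hd1 hc1 hR hkR hkb hL0 hL hβ hC₁ hA hl hlR hD1 hDle
      hDl' hDβ
    have e : ∀ d ∈ Finset.Ioc 0 D, ((μ d : ℂ) / d) * E (l * d) = ((μ d : ℂ) / d) *
        ((∑ m ∈ Finset.range (D + 1 + 1), k (m * (l * d))) - I / (l * d : ℝ) - k 0 / 2) := by
      intro d _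
      simp only [hE, hT, hM]
    rw [Finset.sum_congr rfl e]
    exact h
  calc ‖∑ d ∈ Finset.Ioc 0 D, ((μ d : ℂ) / d) * E (l * d) -
        (I / l) * (S - ∑ d ∈ Finset.Ioc 0 D, (μ d : ℂ) / (d : ℂ) ^ 2) -
        (k 0 / 2) * ∑ d ∈ Finset.Ioc 0 D, (μ d : ℂ) / d‖
      ≤ ‖∑ d ∈ Finset.Ioc 0 D, ((μ d : ℂ) / d) * E (l * d)‖ +
        ‖(I / l) * (S - ∑ d ∈ Finset.Ioc 0 D, (μ d : ℂ) / (d : ℂ) ^ 2)‖ +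
        ‖(k 0 / 2) * ∑ d ∈ Finset.Ioc 0 D, (μ d : ℂ) / d‖ := norm_sub_le_of_le (norm_sub_le _ _) le_rfl
    _ ≤ (C₁ * (2 / R) ^ (-β) * (K₀ + 2 * ‖I‖ / R + ‖k 0‖ / 2) +
          C₁ * (L * R ^ (β + 1) / (β + 1))) * l ^ (-β) +
        ‖I‖ * (C₁ * (2 + 1 / (1 - β))) * (2 / R) ^ (1 - β) * l ^ (-β) +
        ‖k 0‖ / 2 * C₁ * (2 / R) ^ (-β) * l ^ (-β) := add_le_add (add_le_add b1 b2) b3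
    _ = Cst * l ^ (-β) := by rw [hCst]; ring

end HorocycleZeroMode

end Literature.NumberTheory.LFunctions

end
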